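import Mathlib.FieldTheory.IsAlgClosed.AlgebraicClosure
import Mathlib.FieldTheory.PrimitiveElement
import Mathlib.FieldTheory.Perfect
import Mathlib.FieldTheory.Minpoly.IsIntegrallyClosed
import Mathlib.RingTheory.Polynomial.UniqueFactorization
import Mathlib.RingTheory.Polynomial.RationalRoot
import Mathlib.RingTheory.Localization.Integral
import Mathlib.RingTheory.Localization.Away.Basic
import Mathlib.RingTheory.AdicCompletion.Completeness
import Mathlib.RingTheory.Henselian
import Mathlib.RingTheory.MvPowerSeries.Inverse
import Mathlib.Algebra.MvPolynomial.Funext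
import HarnessLib

/-!
# Numeric-to-symbolic transfer, II: algebraic functions as power series
(Garg–Makam–Oliveira–Wigderson 2019, Prop. 3.4 — the elementary Hensel route)

Let `F` be an algebraically closed field of characteristic zero, `A = F[z_σ]` (`σ` finite),
`K = Frac A = F(z)` and `K̄` an algebraic closure. **Proposition 3.4** of
[GargMakamOliveiraWigderson2019] says: for finitely many algebraic functions `b₁, …, b_r ∈ K̄`
there is a point `c ∈ F^σ` (a generic one will do) and an `F`-algebra homomorphism
`F[z, b₁, …, b_r] → F⟦z - c⟧` extending `F[z] ↪ F⟦z - c⟧`. The paper proves it with generic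
smoothness, étale morphisms and completed local rings (§4.2, Lemmas 4.3–4.5). This file provides
the ingredients of an ELEMENTARY proof of the same statement, in the form consumed by the transfer
theorem (`NumericToSymbolicTransfer.lean`):

1. `exists_integral_primitive_element`: all `bⱼ` lie in `K(θ)` for one `θ ∈ K̄` INTEGRAL over `A`
   (primitive element theorem in characteristic zero + clearing denominators).
2. `exists_polynomial_repr`: each `x ∈ K(θ)` is `Q(θ)/s` with `Q ∈ A[X]`, `0 ≠ s ∈ A`.
3. `exists_separability_certificate`: `U·P + V·P' = D` in `A[X]` with `0 ≠ D ∈ A`, `P = minpoly_A θ`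
   (separability of `minpoly_K θ = P` over `K`, `A` integrally closed, denominators cleared).
4. `shift c : A → F⟦X_σ⟧`, `f(z) ↦ f(X + c)` (the inclusion `F[z] ↪ F⟦z - c⟧` after `z ↦ z + c`),
   with constant coefficient `f(c)`; `mem_idealX_of_constantCoeff_eq_zero`: a power series with
   zero constant term lies in the ideal `(X_i)_i` (finitely many variables).
5. `exists_powerSeries_root`: at a point `c` with `D(c) ≠ 0`, `P(c, X)` has a simple root
   `y₀ ∈ F`, and HENSEL'S LEMMA in the complete local ring `F⟦X_σ⟧` (Mathlib:
   `IsAdicComplete.henselianRing` for the ideal `(X_i)`) lifts it to a root `Θ ∈ F⟦X⟧` of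
   `P(X + c, ·)`.
6. `eval₂_shift_eq_zero_of_aeval_eq_zero` (the homomorphism is well defined): `Q(θ) = 0` in `K̄`
   implies `Q(X + c, Θ) = 0` in `F⟦X⟧`, because `P ∣ Q` in `A[X]` (`minpoly.isIntegrallyClosed_dvd`);
   `eval₂_eq_zero_of_isLocalization`: the same after inverting an `S ∈ A` with `S(c) ≠ 0`
   (denominators of the `bⱼ`), which become units in `F⟦X⟧`.

Together: `z ↦ X + c`, `θ ↦ Θ`, `1/S ↦ (S(X+c))⁻¹` is a ring homomorphism `A[1/S][θ] → F⟦X⟧`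
defined on a ring containing `z` and all `bⱼ` — which is Prop. 3.4 with an explicit (Zariski-open)
condition on `c`.

## References

* [GargMakamOliveiraWigderson2019] A. Garg, V. Makam, R. Oliveira, A. Wigderson, *More barriers for
  rank methods, via a "numeric to symbolic" transfer*, FOCS 2019, arXiv:1904.04299; Prop. 3.4
  (§3.2; proof §4.2), Thm. 1.21.
-/

noncomputable section

namespace Literature.RingTheory.PolynomialMaps

open scoped Polynomial IntermediateField

variable {F : Type*} [Field F] {σ : Type*}

local notation "𝔸" => MvPolynomial σ F
local notation "𝕂" => FractionRing (MvPolynomial σ F)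
local notation "𝕂bar" => AlgebraicClosure (FractionRing (MvPolynomial σ F))
local notation "𝓟" => MvPowerSeries σ F

/-! ### The tower `A = F[z] ⊆ K = F(z) ⊆ K̄` -/

/-- `A = F[z] → K̄` is injective. [folklore] -/
theorem algebraMap_algebraicClosure_injective :
    Function.Injective (algebraMap 𝔸 𝕂bar) := by
  rw [IsScalarTower.algebraMap_eq 𝔸 𝕂 𝕂bar]
  exact (algebraMap 𝕂 𝕂bar).injective.comp (IsFractionRing.injective 𝔸 𝕂)

/-- `K̄` is a torsion-free `A`-module (needed for `minpoly` over `A`). [folklore] -/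
theorem isTorsionFree_algebraicClosure : Module.IsTorsionFree 𝔸 𝕂bar :=
  Module.isTorsionFree_iff_faithfulSMul.mpr
    ((faithfulSMul_iff_algebraMap_injective 𝔸 𝕂bar).mpr algebraMap_algebraicClosure_injective)

/-! ### 1. A primitive element, integral over `A` -/

/-- **Primitive element, integral form.** In characteristic zero, finitely many elements
`bⱼ ∈ K̄ = \overline{F(z)}` all lie in `K(θ)` for a single `θ` which is integral over `A = F[z]`
(primitive element theorem for the finite separable extension `K(b₁,…,b_r)/K`, then scaling the
primitive element by a non-zero element of `A`). [folklore] -/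
theorem exists_integral_primitive_element [CharZero F] {τ : Type*} [Finite τ] (b : τ → 𝕂bar) :
    ∃ θ : 𝕂bar, IsIntegral 𝔸 θ ∧ ∀ j, b j ∈ 𝕂⟮θ⟯ := by
  classical
  have hint : ∀ j, IsIntegral 𝕂 (b j) := fun j =>
    (Algebra.IsAlgebraic.isAlgebraic (R := 𝕂) (b j)).isIntegral
  haveI : FiniteDimensional 𝕂 (IntermediateField.adjoin 𝕂 (Set.range b)) :=
    IntermediateField.finiteDimensional_adjoin fun x hx => by
      obtain ⟨j, rfl⟩ := hx
      exact hint j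
  obtain ⟨α, hα⟩ := Field.exists_primitive_element 𝕂 (IntermediateField.adjoin 𝕂 (Set.range b))
  have hEq : IntermediateField.adjoin 𝕂 (Set.range b) = 𝕂⟮(α : 𝕂bar)⟯ := by
    rw [← IntermediateField.lift_adjoin_simple 𝕂 _ α, hα, IntermediateField.lift_top]
  have halgA : IsAlgebraic 𝔸 (α : 𝕂bar) :=
    (IsFractionRing.isAlgebraic_iff 𝔸 𝕂 𝕂bar).mpr (Algebra.IsAlgebraic.isAlgebraic _)
  obtain ⟨y, hy0, hyint⟩ := halgA.exists_integral_multiple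
  refine ⟨y • (α : 𝕂bar), hyint, fun j => ?_⟩
  have hbj : b j ∈ 𝕂⟮(α : 𝕂bar)⟯ := by
    rw [← hEq]
    exact IntermediateField.subset_adjoin 𝕂 _ ⟨j, rfl⟩
  refine (IntermediateField.adjoin_simple_le_iff.mpr ?_) hbj
  have hy : algebraMap 𝔸 𝕂bar y ≠ 0 :=
    (map_ne_zero_iff _ algebraMap_algebraicClosure_injective).mpr hy0
  have hαeq : (α : 𝕂bar) =
      (algebraMap 𝕂 𝕂bar (algebraMap 𝔸 𝕂 y))⁻¹ * (y • (α : 𝕂bar)) := by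
    rw [Algebra.smul_def, ← IsScalarTower.algebraMap_apply, ← mul_assoc, inv_mul_cancel₀ hy,
      one_mul]
  have hmem : (algebraMap 𝕂 𝕂bar (algebraMap 𝔸 𝕂 y))⁻¹ * (y • (α : 𝕂bar)) ∈
      𝕂⟮y • (α : 𝕂bar)⟯ :=
    mul_mem (inv_mem (IntermediateField.algebraMap_mem _ _))
      (IntermediateField.mem_adjoin_simple_self 𝕂 _)
  rwa [← hαeq] at hmem

/-! ### 2. Elements of `K(θ)` as `Q(θ)/s` -/

/-- Every `x ∈ K(θ)`, `θ` integral, is `Q(θ)/s` with `Q ∈ A[X]` and `0 ≠ s ∈ A`: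
`Q(θ) = s · x`. [folklore] -/
theorem exists_polynomial_repr {θ : 𝕂bar} {x : 𝕂bar} (hx : x ∈ 𝕂⟮θ⟯) :
    ∃ (Q : 𝔸[X]) (s : 𝔸), s ≠ 0 ∧ Polynomial.aeval θ Q = algebraMap 𝔸 𝕂bar s * x := by
  have hθK : IsAlgebraic 𝕂 θ := Algebra.IsAlgebraic.isAlgebraic θ
  have hx' : x ∈ (𝕂⟮θ⟯).toSubalgebra := hx
  rw [IntermediateField.adjoin_simple_toSubalgebra_of_isAlgebraic hθK,
    Algebra.adjoin_singleton_eq_range_aeval] at hx'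
  obtain ⟨q, rfl⟩ := hx'
  obtain ⟨s, hs, hQ⟩ := IsLocalization.integerNormalization_spec (nonZeroDivisors 𝔸) q
  refine ⟨IsLocalization.integerNormalization (nonZeroDivisors 𝔸) q, s, nonZeroDivisors.ne_zero hs,
    ?_⟩
  rw [← Polynomial.aeval_map_algebraMap 𝕂, hQ, Algebra.smul_def, Polynomial.algebraMap_apply,
    map_mul, Polynomial.aeval_C, ← IsScalarTower.algebraMap_apply]
  rfl

/-! ### 3. The separability certificate `U P + V P' = D` -/

/-- For `θ ∈ K̄` integral over `A = F[z]` (characteristic zero), the minimal polynomial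
`P = minpoly_A θ` satisfies `U·P + V·P' = D` for some `U, V ∈ A[X]` and `0 ≠ D ∈ A` (a cleared
form of the separability of `minpoly_K θ = P`). [folklore] -/
theorem exists_separability_certificate [CharZero F] {θ : 𝕂bar} (hθ : IsIntegral 𝔸 θ) :
    ∃ (U V : 𝔸[X]) (D : 𝔸), D ≠ 0 ∧
      U * minpoly 𝔸 θ + V * Polynomial.derivative (minpoly 𝔸 θ) = Polynomial.C D := by
  have hsep : (minpoly 𝕂 θ).Separable := Algebra.IsSeparable.isSeparable 𝕂 θ
  rw [minpoly.isIntegrallyClosed_eq_field_fractions' 𝕂 hθ, Polynomial.Separable,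
    Polynomial.derivative_map] at hsep
  obtain ⟨u, v, huv⟩ := hsep
  obtain ⟨t₁, ht₁, hU⟩ := IsLocalization.integerNormalization_spec (nonZeroDivisors 𝔸) u
  obtain ⟨t₂, ht₂, hV⟩ := IsLocalization.integerNormalization_spec (nonZeroDivisors 𝔸) v
  refine ⟨Polynomial.C t₂ * IsLocalization.integerNormalization (nonZeroDivisors 𝔸) u,
    Polynomial.C t₁ * IsLocalization.integerNormalization (nonZeroDivisors 𝔸) v, t₁ * t₂,
    mul_ne_zero (nonZeroDivisors.ne_zero ht₁) (nonZeroDivisors.ne_zero ht₂), ?_⟩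
  apply Polynomial.map_injective _ (IsFractionRing.injective 𝔸 𝕂)
  simp only [Polynomial.map_add, Polynomial.map_mul, Polynomial.map_C, hU, hV, map_mul]
  rw [Algebra.smul_def, Algebra.smul_def, Polynomial.algebraMap_apply, Polynomial.algebraMap_apply]
  linear_combination
    (Polynomial.C (algebraMap 𝔸 𝕂 t₁) * Polynomial.C (algebraMap 𝔸 𝕂 t₂)) * huv

/-! ### 4. Generic points and the shift `z ↦ X + c` into power series -/

/-- A non-zero polynomial over an infinite field has a non-root. [folklore] -/
theorem exists_eval_ne_zero [Infinite F] {g : 𝔸} (hg : g ≠ 0) :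
    ∃ c : σ → F, MvPolynomial.eval c g ≠ 0 := by
  by_contra h
  simp only [not_exists, not_not] at h
  exact hg (MvPolynomial.funext fun c => by rw [h c, map_zero])

/-- The substitution `f(z) ↦ f(X + c) ∈ F⟦X_σ⟧` — the inclusion `F[z] ↪ F⟦z - c⟧` of
[GargMakamOliveiraWigderson2019, Prop. 3.4] written after the change of variables `z ↦ z + c`
of Thm. 1.21. [cite: GargMakamOliveiraWigderson2019, Prop. 3.4] -/
def shift (c : σ → F) : 𝔸 →+* 𝓟 :=
  MvPolynomial.eval₂Hom MvPowerSeries.C fun i => MvPowerSeries.X i + MvPowerSeries.C (c i)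

/-- `shift c` on constants. [folklore] -/
@[simp] theorem shift_C (c : σ → F) (a : F) : shift c (MvPolynomial.C a) = MvPowerSeries.C a := by
  simp [shift]

/-- `shift c` on variables: `zᵢ ↦ Xᵢ + cᵢ`. [folklore] -/
@[simp] theorem shift_X (c : σ → F) (i : σ) :
    shift c (MvPolynomial.X i) = MvPowerSeries.X i + MvPowerSeries.C (c i) := by
  simp [shift]

/-- The constant term of `f(X + c)` is `f(c)`. [folklore] -/
theorem constantCoeff_comp_shift (c : σ → F) :
    MvPowerSeries.constantCoeff.comp (shift c) = MvPolynomial.eval c := by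
  refine MvPolynomial.ringHom_ext (fun r => ?_) (fun i => ?_)
  · simp
  · simp

/-- The constant term of `f(X + c)` is `f(c)`. [folklore] -/
theorem constantCoeff_shift (c : σ → F) (g : 𝔸) :
    MvPowerSeries.constantCoeff (shift c g) = MvPolynomial.eval c g :=
  RingHom.congr_fun (constantCoeff_comp_shift c) g

/-- `f(X + c)` is a unit of `F⟦X⟧` when `f(c) ≠ 0`. [folklore] -/
theorem isUnit_shift (c : σ → F) {g : 𝔸} (hg : MvPolynomial.eval c g ≠ 0) : IsUnit (shift c g) :=
  MvPowerSeries.isUnit_iff_constantCoeff.mpr (by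
    rw [constantCoeff_shift]
    exact isUnit_iff_ne_zero.mpr hg)

/-- In finitely many variables, a power series with zero constant term lies in the ideal
`(Xᵢ)ᵢ`. [folklore] -/
theorem mem_idealX_of_constantCoeff_eq_zero [Finite σ] {R : Type*} [CommRing R]
    {φ : MvPowerSeries σ R} (h : MvPowerSeries.constantCoeff φ = 0) :
    φ ∈ Ideal.span (Set.range (MvPowerSeries.X : σ → MvPowerSeries σ R)) := by
  classical
  suffices key : ∀ (s : Finset σ) (ψ : MvPowerSeries σ R),
      (∀ m : σ →₀ ℕ, (∀ i ∈ s, m i = 0) → MvPowerSeries.coeff m ψ = 0) →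
      ψ ∈ Ideal.span ((fun i => (MvPowerSeries.X i : MvPowerSeries σ R)) '' (s : Set σ)) by
    haveI := Fintype.ofFinite σ
    have := key Finset.univ φ fun m hm => by
      have hm0 : m = 0 := Finsupp.ext fun i => hm i (Finset.mem_univ i)
      rw [hm0, MvPowerSeries.coeff_zero_eq_constantCoeff_apply, h]
    simpa [Set.image_univ] using this
  intro s
  induction s using Finset.induction_on with
  | empty =>
    intro ψ hψ
    have : ψ = 0 := MvPowerSeries.ext fun m => by simpa using hψ m (by simp)
    simp [this]
  | insert a s ha ih =>
    intro ψ hψ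
    let ψ₁ : MvPowerSeries σ R := fun m => if m a = 0 then 0 else ψ m
    let ψ₂ : MvPowerSeries σ R := fun m => if m a = 0 then ψ m else 0
    have hsplit : ψ = ψ₁ + ψ₂ := by
      refine MvPowerSeries.ext fun m => ?_
      rw [map_add]
      change ψ m = (if m a = 0 then 0 else ψ m) + (if m a = 0 then ψ m else 0)
      split_ifs <;> simp
    have h1 : (MvPowerSeries.X a : MvPowerSeries σ R) ∣ ψ₁ :=
      MvPowerSeries.X_dvd_iff.mpr fun m hm => by
        change (if m a = 0 then 0 else ψ m) = 0
        simp [hm]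
    have h2 : ψ₂ ∈ Ideal.span ((fun i => (MvPowerSeries.X i : MvPowerSeries σ R)) '' (s : Set σ)) :=
      ih ψ₂ fun m hm => by
        change (if m a = 0 then ψ m else 0) = 0
        split_ifs with hma
        · exact hψ m fun i hi => by
            rcases Finset.mem_insert.1 hi with rfl | hi
            · exact hma
            · exact hm i hi
        · rfl
    rw [hsplit]
    refine Ideal.add_mem _ ?_ (Ideal.span_mono (Set.image_mono (by simp)) h2)
    obtain ⟨χ, hχ⟩ := h1
    rw [hχ]
    exact Ideal.mul_mem_right _ _ (Ideal.subset_span ⟨a, by simp, rfl⟩)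

/-! ### 5. Hensel: a power-series root of `P(X + c, ·)` above a simple root of `P(c, ·)` -/

/-- Constant terms commute with evaluating `Q(X + c, ·)` at a constant. [folklore] -/
theorem constantCoeff_eval_map_shift (c : σ → F) (Q : 𝔸[X]) (y : F) :
    MvPowerSeries.constantCoeff ((Q.map (shift c)).eval (MvPowerSeries.C y)) =
      (Q.map (MvPolynomial.eval c)).eval y := by
  rw [Polynomial.eval_map, Polynomial.hom_eval₂, constantCoeff_comp_shift,
    MvPowerSeries.constantCoeff_C, Polynomial.eval_map]

/-- **Hensel step.** Let `P ∈ A[X]` be monic of positive degree with `U P + V P' = D`, and `c` a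
point with `D(c) ≠ 0`. Then `P(X + c, ·)` has a root `Θ` in the power-series ring `F⟦X_σ⟧`
(`F` algebraically closed: a root `y₀` of `P(c, ·)` exists and is simple; `F⟦X⟧` is Henselian
for the ideal `(Xᵢ)` as it is adically complete). This replaces the étale-local argument of
[GargMakamOliveiraWigderson2019, Lemmas 4.4–4.5]. [folklore] -/
theorem exists_powerSeries_root [IsAlgClosed F] [Finite σ] {P U V : 𝔸[X]} {D : 𝔸}
    (hP : P.Monic) (hdeg : 0 < P.natDegree)
    (hUV : U * P + V * Polynomial.derivative P = Polynomial.C D) {c : σ → F}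
    (hc : MvPolynomial.eval c D ≠ 0) :
    ∃ Θ : 𝓟, (P.map (shift c)).IsRoot Θ := by
  classical
  have hPc_deg : (P.map (MvPolynomial.eval c)).degree ≠ 0 := by
    rw [Polynomial.degree_eq_natDegree (hP.map _).ne_zero, hP.natDegree_map]
    exact_mod_cast hdeg.ne'
  obtain ⟨y₀, hy₀⟩ := IsAlgClosed.exists_root _ hPc_deg
  have hderiv : (Polynomial.derivative (P.map (MvPolynomial.eval c))).eval y₀ ≠ 0 := by
    have h := congrArg (fun Q : 𝔸[X] => (Q.map (MvPolynomial.eval c)).eval y₀) hUV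
    simp only [Polynomial.map_add, Polynomial.map_mul, Polynomial.eval_add, Polynomial.eval_mul,
      Polynomial.map_C, Polynomial.eval_C] at h
    rw [hy₀.eq_zero, mul_zero, zero_add, ← Polynomial.derivative_map] at h
    intro h0
    rw [h0, mul_zero] at h
    exact hc h.symm
  obtain ⟨Θ, hΘ, -⟩ := HenselianRing.is_henselian (I := Ideal.span (Set.range MvPowerSeries.X))
    (P.map (shift c)) (hP.map _) (MvPowerSeries.C y₀)
    (mem_idealX_of_constantCoeff_eq_zero (by rw [constantCoeff_eval_map_shift]; exact hy₀.eq_zero))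
    (by
      refine IsUnit.map _ ?_
      rw [Polynomial.derivative_map, MvPowerSeries.isUnit_iff_constantCoeff,
        constantCoeff_eval_map_shift, ← Polynomial.derivative_map]
      exact isUnit_iff_ne_zero.mpr hderiv)
  exact ⟨Θ, hΘ⟩

/-! ### 6. The substitution `θ ↦ Θ` is well defined -/

/-- **Kernel lemma.** If `Θ ∈ F⟦X⟧` is a root of `P(X + c, ·)`, `P = minpoly_A θ`, then every
`Q ∈ A[X]` with `Q(θ) = 0` in `K̄` satisfies `Q(X + c, Θ) = 0`: the assignment `z ↦ X + c`,
`θ ↦ Θ` is a ring homomorphism `A[θ] → F⟦X⟧` (cf. the homomorphism of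
[GargMakamOliveiraWigderson2019, Prop. 3.4]). [folklore] -/
theorem eval₂_shift_eq_zero_of_aeval_eq_zero {θ : 𝕂bar} (hθ : IsIntegral 𝔸 θ) {c : σ → F}
    {Θ : 𝓟} (hΘ : ((minpoly 𝔸 θ).map (shift c)).IsRoot Θ) {Q : 𝔸[X]}
    (hQ : Polynomial.aeval θ Q = 0) : Q.eval₂ (shift c) Θ = 0 := by
  haveI : Module.IsTorsionFree 𝔸 𝕂bar := isTorsionFree_algebraicClosure
  obtain ⟨R, hR⟩ := minpoly.isIntegrallyClosed_dvd hθ hQ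
  rw [hR, Polynomial.eval₂_mul, ← Polynomial.eval_map, hΘ.eq_zero, zero_mul]

/-- **Kernel lemma with denominators.** Same as `eval₂_shift_eq_zero_of_aeval_eq_zero` over a
localisation `B = A[1/S]` with `S(c) ≠ 0`: for ring homomorphisms `f_Ω : B → K̄` over `A → K̄` and
`f_P : B → F⟦X⟧` over `shift c`, every `Q ∈ B[X]` with `Q(θ) = 0` has `Q(Θ) = 0`. [folklore] -/
theorem eval₂_eq_zero_of_isLocalization {θ : 𝕂bar} (hθ : IsIntegral 𝔸 θ) {c : σ → F}
    {Θ : 𝓟} (hΘ : ((minpoly 𝔸 θ).map (shift c)).IsRoot Θ) {S : 𝔸}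
    (hSc : MvPolynomial.eval c S ≠ 0) {B : Type*} [CommRing B] [Algebra 𝔸 B]
    [IsLocalization.Away S B] {fΩ : B →+* 𝕂bar} (hfΩ : fΩ.comp (algebraMap 𝔸 B) = algebraMap 𝔸 𝕂bar)
    {fP : B →+* 𝓟} (hfP : fP.comp (algebraMap 𝔸 B) = shift c) {Q : B[X]}
    (hQ : Q.eval₂ fΩ θ = 0) : Q.eval₂ fP Θ = 0 := by
  obtain ⟨u, hu, hQu⟩ := IsLocalization.integerNormalization_spec (Submonoid.powers S) Q
  have h1 : Polynomial.aeval θ (IsLocalization.integerNormalization (Submonoid.powers S) Q) = 0 := by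
    rw [Polynomial.aeval_def, ← hfΩ, ← Polynomial.eval₂_map, hQu, Algebra.smul_def,
      Polynomial.algebraMap_apply, Polynomial.eval₂_mul, Polynomial.eval₂_C, hQ, mul_zero]
  have h2 := eval₂_shift_eq_zero_of_aeval_eq_zero hθ hΘ h1
  rw [← hfP, ← Polynomial.eval₂_map, hQu, Algebra.smul_def, Polynomial.algebraMap_apply,
    Polynomial.eval₂_mul, Polynomial.eval₂_C] at h2
  have hunit : IsUnit (fP (algebraMap 𝔸 B u)) := by
    obtain ⟨n, rfl⟩ := hu
    rw [← RingHom.comp_apply, hfP, map_pow]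
    exact (isUnit_shift c hSc).pow n
  exact hunit.mul_right_eq_zero.mp h2

end Literature.RingTheory.PolynomialMaps
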